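import Summits.BirchSwinnertonDyer.BirchSwinnertonDyer.Theorems.ErratumRoadFiveNonSurjCornerFiveInstanceEstar
import HarnessLib

/-!
# Route `ErratumRoadFive` (rung K2), crux `NonSurjCorner` (item stmt-BirchSwinnertonDyer-19065), gen-3 DEEP children
# 23046 `NonSurjCornerKolyZDeep` ∕ 23047 `NonSurjCornerTwinMuAnDeep`: NEW DEEP CORNER PAIRS AT `p = 5` BEYOND THE CENSUS BOX AS KERNEL INSTANCES,
# PART D: `J9t7o10d2` (`t = 7/10`, `d = 2`) and `J9t-13o10d43` (`t = -13/10`, `d = 43`)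
# (cell `bsd-stepL`, seat `bsd-stepL-corner5-p2` g15, WIDTH-LEVER lane B; `--supports stmt-BirchSwinnertonDyer-23047 --as helper`)

WHY ∕ METHOD: as in parts A ∕ B (p721960 ∕ p722003; template `…FiveInstanceEstar`). Lane B g15's deep hunt, THIRD band (kit j332850: ALL 9 371 root-number −1
members of Zywina's `X_{G₉}` family `j = J₉(t)`, `t = a/b`, `5 ∣ b`, `|a| ≤ 400`, `b ≤ 200`, twists `|d| ≤ 300`, with `10¹² < N ≤ 4·10¹²`; per pair `ellrank` effort 2 → saturation →
ĥ, `ellL1` → `L'(E,1)`, `#Ш_an = X∕ĥ`): 9 029 corner pairs, 6 072 decided, and TEN with `#Ш_an = 25`, each re-verified at 38 digits by kit j333674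
(`ellanalyticrank` = 1 with `L'` = `ellL1` = `lfun`; `ellrank` = `[1, 1, 0]` — rank EXACTLY 1 by 2-descent; generator saturated at every prime ≤ 500; `#Ш_an = 25.000…`).
THIS FILE (part D): the pairs `J9t7o10d2` and `J9t-13o10d43` as BY-NAME kernel instances — every ALGEBRAIC hypothesis of the deep children decided in the kernel from the literal integer model
(discriminant and `c₄` with factorisations, global minimality by Silverman's bounded criterion — Kraus at `2` where `2¹² ∣ Δ` —, multiplicative reduction at `5` with
`5 ∣ ord₅ Δ_min`, irreducibility of `E[5]` by a Frobenius no-root witness, the multiplicative primes, hence no (ram) witness), `ρ̄_{E,5}` NOT onto a THEOREM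
(`j(E) = J₉(t)`, the tree's `zywina2015_thm14_not_surjective_five_of_j_eq_J9_holds`), the two ANALYTIC hypotheses (`r_an = 1`, `0 < ord₅ #Ш_an`) displayed binders
`hr`, `hSha` in `deepHypotheses` ∕ `twinMuAnDeep_at`.
* `J9t7o10d2` (namespace `T7o10d2`): `t = 7/10`, `[0, -1, 0, 944319, -3763619519]`, `N = 3275771305280 = 2⁶·5·23²·53²·83²`, `ord₅ Δ_min = 5` — `5` the only multiplicative prime; numerics `L'(E,1) = 36.0315334…`, `ĥ = 5.63013019…`, `X = 140.7532547…`, `#Ш_an = 25.0000…`; first Heegner fields `d_K = -471, -799, -1031, -1279, …`.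
* `J9t-13o10d43` (namespace `Tm13o10d43`): `t = -13/10`, `[0, 0, 0, -1212402243, -78518091456958]`, `N = 1831746759120 = 2⁴·3⁴·5·17²·23²·43²`, `ord₅ Δ_min = 5` — `5` the only multiplicative prime; numerics `L'(E,1) = 13.4779954…`, `ĥ = 12.2879332…`, `X = 307.1983324…`, `#Ш_an = 25.0000…`; first Heegner fields `d_K = -191, -1919, -2039, -2399, …`.

HONEST FRAMING: theorems about explicit curves only; no definition, no named fact, no `sorry`; CONDITIONAL only on the displayed analytic binders where they appear;
nothing is booked; 23046 ∕ 23047 ∕ 19065 stay OPEN (class-wide: Kolyvagin's refined conjecture ∕ Greenberg's Conj. 1.11 at a non-surjective irreducible image with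
`p ∥ N`); BSD is proved for no curve; no census word, tier or label moves (T7). Memo `HOME/corner5/g15/CORNER5-P2-G15.md`; data `HOME/corner5/g15/data/hunt5/`
(HUNT5-P3-N4e12.census.tsv), `…/verify10/`. References: as in part A. -/

set_option linter.dupNamespace false
set_option autoImplicit false

noncomputable section
open scoped Classical
open WeierstrassCurve Literature.NumberTheory.EllipticCurves
  Literature.NumberTheory.EllipticCurves.Rank1Residual
  Literature.NumberTheory.EllipticCurves.Rank1Residual.X11RankOneCertificates
  Summit.BirchSwinnertonDyer.BirchSwinnertonDyer.Rank1Residual.IntModel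
  Summit.BirchSwinnertonDyer.Rank1Residual Summit.BirchSwinnertonDyer.Rank1Residual.X11b

namespace Summit.BirchSwinnertonDyer.BirchSwinnertonDyer.Theorems.CornerFive

/-! ## Kernel pair facts of `E₀ = [0, -1, 0, 944319, -3763619519]` (`J9t7o10d2`, `j = J₉(7/10)`, `N = 3275771305280 = 2⁶·5·23²·53²·83²`) at `p = 5` -/

namespace T7o10d2

/-- `Δ(E₀) = -6172077262556364800000`. [cite: SilvermanAEC2009, III.1] -/
theorem Δ_eq : (⟨0, -1, 0, 944319, -3763619519⟩ : WeierstrassCurve ℤ).Δ = -6172077262556364800000 := by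
  decide

/-- `Δ(E₀) = -2²³·5⁵·23³·53²·83²` (bad primes `2, 5, 23, 53, 83`; `N = 2⁶·5·23²·53²·83²`). [cite: SilvermanAEC2009, VII.5 Prop. 5.1] -/
theorem Δ_eq_factored : (⟨0, -1, 0, 944319, -3763619519⟩ : WeierstrassCurve ℤ).Δ =
    -(2 ^ 23 * 5 ^ 5 * 23 ^ 3 * 53 ^ 2 * 83 ^ 2) := by
  rw [Δ_eq]; norm_num

/-- `c₄(E₀) = -45327296 = 2⁶·7·23·53·83`. [cite: SilvermanAEC2009, III.1] -/
theorem c₄_eq : (⟨0, -1, 0, 944319, -3763619519⟩ : WeierstrassCurve ℤ).c₄ = -45327296 := by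
  decide

/-- `#Ẽ₀(𝔽_7) = 3` (`a_7 = 5`), kernel-decided. [cite: SilvermanAEC2009, V.2] -/
theorem card_F7 : Nat.card (((⟨0, -1, 0, 944319, -3763619519⟩ : WeierstrassCurve ℤ).map
    (Int.castRingHom (ZMod 7))).toAffine.Point) = 3 := by
  rw [@natCard_point_eq_one_add_card (ZMod 7) (@ZMod.instField 7 ⟨by norm_num⟩) _ _ _ (by decide)]
  decide

/-- `E` is an elliptic curve (`Δ ≠ 0`). [cite: SilvermanAEC2009, III.1] -/
theorem isElliptic (W : WeierstrassCurve ℚ) (hW : W = ⟨0, -1, 0, 944319, -3763619519⟩) : W.IsElliptic := by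
  subst hW; exact isElliptic_of_discOf_ne_zero 0 (-1) 0 944319 (-3763619519) (by decide +kernel)

/-- The model is GLOBALLY MINIMAL: Silverman's criterion at every odd prime below `128` (all `ord_q Δ < 12` there), `|Δ| < 128¹²`,
and Kraus's condition at `2` (`2²³ ∥ Δ`, `2⁶ ∥ c₄`, `2⁹ ∥ c₆`). [cite: Kraus1989, Prop. 1] [cite: SilvermanAEC2009, VII.1 Remark 1.1] -/
theorem isGloballyMinimal (W : WeierstrassCurve ℚ) (hW : W = ⟨0, -1, 0, 944319, -3763619519⟩) : W.IsGloballyMinimal := by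
  subst hW
  exact isGloballyMinimal_of_kraus_two_bounded 0 (-1) 0 944319 (-3763619519) 128
    (by decide +kernel) (by decide +kernel) (by decide +kernel) (by decide +kernel)

/-- The tree's integral model of `E` is `E₀`. [folklore] -/
theorem integralModelInt_eq (W : WeierstrassCurve ℚ) (hW : W = ⟨0, -1, 0, 944319, -3763619519⟩) [W.IsGloballyMinimal] :
    integralModelInt W = ⟨0, -1, 0, 944319, -3763619519⟩ := by
  subst hW; exact integralModelInt_eq_of_map_eq _ (map_mk_int _ _ _ _ _)

/-- `E` as the base change of its integer model. [folklore] -/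
theorem eq_baseChange (W : WeierstrassCurve ℚ) (hW : W = ⟨0, -1, 0, 944319, -3763619519⟩) :
    W = (⟨0, -1, 0, 944319, -3763619519⟩ : WeierstrassCurve ℤ).baseChange ℚ := by
  rw [hW]; ext <;> simp [WeierstrassCurve.baseChange, WeierstrassCurve.map]

/-- **Multiplicative reduction at `5`** (`5 ∣ Δ`, `5 ∤ c₄`). [cite: SilvermanAEC2009, VII.5 Prop. 5.1(b)] -/
theorem mult_five (W : WeierstrassCurve ℚ) (hW : W = ⟨0, -1, 0, 944319, -3763619519⟩) [W.IsElliptic] [W.IsGloballyMinimal]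
    [Fact (Nat.Prime 5)] : Mult W 5 :=
  hasMultiplicativeReductionAtPrime_of_intModel (integralModelInt_eq W hW) 5
    (by rw [Δ_eq]; decide) (by rw [c₄_eq]; decide)

/-- `ord₅ Δ_min(E) = 5`. [cite: SilvermanAEC2009, VII.5 Prop. 5.1(b)] -/
theorem padicValInt_five (W : WeierstrassCurve ℚ) (hW : W = ⟨0, -1, 0, 944319, -3763619519⟩) [W.IsElliptic] [W.IsGloballyMinimal]
    [Fact (Nat.Prime 5)] : padicValInt 5 W.minimalDiscriminantInt = 5 := by
  rw [minimalDiscriminantInt_eq (integralModelInt_eq W hW), Δ_eq]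
  exact padicValInt_eq_of_dvd_of_not_dvd 5 (by decide) (by decide)

/-- The crux binder **`5 ∣ ord₅ Δ_min(E)`** (`5 = 5·1`). [cite: SilvermanAEC2009, VII.5 Prop. 5.1(b)] -/
theorem dvd_padicValInt_five (W : WeierstrassCurve ℚ) (hW : W = ⟨0, -1, 0, 944319, -3763619519⟩) [W.IsElliptic] [W.IsGloballyMinimal]
    [Fact (Nat.Prime 5)] : (5 : ℕ) ∣ padicValInt 5 W.minimalDiscriminantInt := by
  have h := padicValInt_five W hW
  omega

/-- **`E[5]` is irreducible**: Frobenius no-root witness at the good prime `ℓ = 7` (`a₇ = 5`, `X² − 5X + 7` root-free mod `5`;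
Mazur 1978 Prop. 6.3 (1)). [cite: Mazur1978, §6 Prop. 6.3 (1) (p. 153)] -/
theorem irr_five (W : WeierstrassCurve ℚ) (hW : W = ⟨0, -1, 0, 944319, -3763619519⟩) [W.IsElliptic] [W.IsGloballyMinimal]
    [Fact (Nat.Prime 5)] : Irr W 5 :=
  haveI : Fact (Nat.Prime 7) := ⟨by norm_num⟩
  hasIrreducibleModPGaloisRep_of_intModel_of_noroot (integralModelInt_eq W hW) 5 7
    (by decide) (by rw [Δ_eq]; decide) card_F7
    (of_decide_eq_true rfl)

/-- **Every prime of multiplicative reduction of `E` is `5`**: it divides `Δ = -2²³·5⁵·23³·53²·83²`, and `2`, `23`, `53`, `83` are additive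
(`q ∣ Δ`, `q ∣ c₄` at the globally minimal model). [cite: SilvermanAEC2009, VII.5 Prop. 5.1] -/
theorem eq_five_of_mult (W : WeierstrassCurve ℚ) (hW : W = ⟨0, -1, 0, 944319, -3763619519⟩) [W.IsElliptic] [W.IsGloballyMinimal]
    {ℓ : ℕ} [hℓ : Fact ℓ.Prime] (hm : Mult W ℓ) : ℓ = 5 := by
  have hI := integralModelInt_eq W hW
  have hdvd : (ℓ : ℤ) ∣ (⟨0, -1, 0, 944319, -3763619519⟩ : WeierstrassCurve ℤ).Δ := by
    by_contra hnd
    exact (hasGoodReductionAtPrime_of_not_dvd W ℓ (by rwa [minimalDiscriminantInt_eq hI])).not_hasMultiplicativeReduction _ hm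
  rw [Δ_eq_factored, Int.dvd_neg, Int.natCast_dvd] at hdvd
  simp only [Int.natAbs_mul, Int.natAbs_pow] at hdvd
  have hp := hℓ.out
  have hadd : ∀ q : ℕ, [Fact q.Prime] → (q : ℤ) ∣ (⟨0, -1, 0, 944319, -3763619519⟩ : WeierstrassCurve ℤ).Δ →
      (q : ℤ) ∣ (⟨0, -1, 0, 944319, -3763619519⟩ : WeierstrassCurve ℤ).c₄ → ¬ Mult W q :=
    fun q _ hΔ hc ↦ not_hasMultiplicativeReductionAtPrime_of_intModel_of_dvd_of_dvd hI q hΔ hc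
  rcases (Nat.Prime.dvd_mul hp).mp hdvd with hdvd | h83
  · rcases (Nat.Prime.dvd_mul hp).mp hdvd with hdvd | h53
    · rcases (Nat.Prime.dvd_mul hp).mp hdvd with hdvd | h23
      · rcases (Nat.Prime.dvd_mul hp).mp hdvd with hdvd | h5
        · exfalso
          have h' : ℓ = 2 := (Nat.prime_dvd_prime_iff_eq hp (by norm_num : Nat.Prime 2)).mp (hp.dvd_of_dvd_pow hdvd)
          subst h'
          exact hadd 2 (by rw [Δ_eq]; decide) (by rw [c₄_eq]; decide) hm
        · exact (Nat.prime_dvd_prime_iff_eq hp (by norm_num : Nat.Prime 5)).mp (hp.dvd_of_dvd_pow h5)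
      · exfalso
        have h' : ℓ = 23 := (Nat.prime_dvd_prime_iff_eq hp (by norm_num : Nat.Prime 23)).mp (hp.dvd_of_dvd_pow h23)
        subst h'
        exact hadd 23 (by rw [Δ_eq]; decide) (by rw [c₄_eq]; decide) hm
    · exfalso
      have h' : ℓ = 53 := (Nat.prime_dvd_prime_iff_eq hp (by norm_num : Nat.Prime 53)).mp (hp.dvd_of_dvd_pow h53)
      subst h'
      exact hadd 53 (by rw [Δ_eq]; decide) (by rw [c₄_eq]; decide) hm
  · exfalso
    have h' : ℓ = 83 := (Nat.prime_dvd_prime_iff_eq hp (by norm_num : Nat.Prime 83)).mp (hp.dvd_of_dvd_pow h83)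
    subst h'
    exact hadd 83 (by rw [Δ_eq]; decide) (by rw [c₄_eq]; decide) hm

/-- The crux binder **no (ram) witness at `5`**: `E` has no multiplicative prime other than `5`.
[cite: SkinnerUrban2014, Thm. 2 (p. 3), hypothesis (ram)] -/
theorem not_ram_five (W : WeierstrassCurve ℚ) (hW : W = ⟨0, -1, 0, 944319, -3763619519⟩) [W.IsElliptic] [W.IsGloballyMinimal]
    [Fact (Nat.Prime 5)] : ¬ Ram W 5 := by
  rintro ⟨ℓ, hℓ, hne, hm, -⟩
  exact hne (eq_five_of_mult W hW hm)

/-- **`j(E) = J₉(7/10)`** on Zywina's `X_{G₉}` j-line: `j = c₄³/Δ = 1508857/100000 = t³(t² + 5t + 40)` at `t = 7/10`.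
[cite: Zywina2015, §1.3 (J₉) and Thm. 1.4 (arXiv:1508.07660)] -/
theorem j_eq_J9 (W : WeierstrassCurve ℚ) (hW : W = ⟨0, -1, 0, 944319, -3763619519⟩) [W.IsElliptic] :
    W.j = (7 / 10 : ℚ) ^ 3 * ((7 / 10 : ℚ) ^ 2 + 5 * (7 / 10) + 40) := by
  have hW' := eq_baseChange W hW
  subst hW'
  rw [j_baseChange_int, c₄_eq, Δ_eq]; norm_num

/-- **`ρ̄_{E,5}` is NOT onto** — a THEOREM: `E` is non-CM (multiplicative at `5`) and `j(E) = J₉(7/10)`, so the tree's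
`zywina2015_thm14_not_surjective_five_of_j_eq_J9_holds` applies. [cite: Zywina2015, Thm. 1.4 (i = 9) (arXiv:1508.07660)]
[cite: SilvermanATAEC1994, Thm. II.6.4] -/
theorem not_surj_five (W : WeierstrassCurve ℚ) (hW : W = ⟨0, -1, 0, 944319, -3763619519⟩) [W.IsElliptic] [W.IsGloballyMinimal]
    [Fact (Nat.Prime 5)] : ¬ Surj W 5 :=
  zywina2015_thm14_not_surjective_five_of_j_eq_J9_holds W
    (fun hCM ↦ not_hasMultiplicativeReductionAtPrime_of_hasCM W hCM 5 (mult_five W hW)) (7 / 10) (j_eq_J9 W hW)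

/-- **`(E, 5) ∈ X11b`** given `r_an(E) = 1` (`hr`; numerics: root number `−1`, `L'(E,1) = 36.0315334…`, `ellrank` = `[1,1,0]`, lane B g15 kit j331690).
[cite: Miller2011LMS, §1] -/
theorem classX11b_five (W : WeierstrassCurve ℚ) (hW : W = ⟨0, -1, 0, 944319, -3763619519⟩) [W.IsElliptic] [W.IsGloballyMinimal]
    [Fact (Nat.Prime 5)] (hr : W.analyticRank = 1) : ClassX11b W 5 :=
  ⟨hr, by decide, mult_five W hW, irr_five W hW⟩

/-- **THE DEEP CHILDREN ARE INHABITED AT `(J9t7o10d2, 5)` modulo two analytic numerics**: the common outer hypotheses of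
`Theorems.NonSurjCornerKolyZDeep` (23046) and `Theorems.NonSurjCornerTwinMuAnDeep` (23047) hold at `E` given `hr : r_an = 1` and
`hSha : ∃ s, shaAn E = s ∧ 0 < ord₅ s` (numerics, kit j331491 ∕ j331690 at 38 digits: `L'(E,1) = 36.0315334…`, generator of height `ĥ = 5.63013019…`
saturated at every prime `≤ 500`, `X = L'(E,1)·#tors²∕(Ω·∏c) = 140.7532547…`, `#Ш(E)_an = X∕ĥ = 25.000000…`). [cite: Zywina2015, Thm. 1.4 (i = 9)]
[cite: GrossZagier1986, Thm. I.6.3 (the L'-value behind #Ш_an)] -/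
theorem deepHypotheses (W : WeierstrassCurve ℚ) (hW : W = ⟨0, -1, 0, 944319, -3763619519⟩) [W.IsElliptic]
    [W.IsGloballyMinimal] [Fact (Nat.Prime 5)] (hr : W.analyticRank = 1)
    (hSha : ∃ s : ℚ, shaAn W = (s : ℂ) ∧ 0 < padicValRat 5 s) :
    ClassX11b W 5 ∧ ¬ Surj W 5 ∧ ((5 : ℕ) = 5 ∨ (5 : ℕ) = 7) ∧
      (5 : ℕ) ∣ padicValInt 5 W.minimalDiscriminantInt ∧ ¬ Ram W 5 ∧
      (∃ s : ℚ, shaAn W = (s : ℂ) ∧ 0 < padicValRat 5 s) :=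
  ⟨classX11b_five W hW hr, not_surj_five W hW, Or.inl rfl, dvd_padicValInt_five W hW, not_ram_five W hW, hSha⟩

/-- **What 23047 says at `J9t7o10d2`** (its inner statement at this pair, for every Heegner field `K` with `L(E^{(d_K)},1) ≠ 0` and every model of
the twist), from the decl BY NAME and the two analytic binders. Nothing is asserted: the decl is a hypothesis. [cite: GreenbergLNM1716, §1 Conj. 1.11 (p. 61) (shape)] -/
theorem twinMuAnDeep_at (h : NonSurjCornerTwinMuAnDeep)
    (W : WeierstrassCurve ℚ) (hW : W = ⟨0, -1, 0, 944319, -3763619519⟩) [W.IsElliptic] [W.IsGloballyMinimal]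
    [Fact (Nat.Prime 5)] (hr : W.analyticRank = 1) (hSha : ∃ s : ℚ, shaAn W = (s : ℂ) ∧ 0 < padicValRat 5 s)
    (K : Type) [Field K] [NumberField K] (Wd : WeierstrassCurve ℚ) [Wd.IsElliptic] [Wd.IsGloballyMinimal] (Cd : VariableChange ℚ)
    (hK : IsImaginaryQuadratic K) (hH : SatisfiesHeegnerHypothesis (W.conductorNorm ℤ) K)
    (hL : (W.quadraticTwist (NumberField.discr K : ℚ)).entireLFunction 1 ≠ 0)
    (hCd : Cd • W.quadraticTwist (NumberField.discr K : ℚ) = Wd)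
    (hXd : ClassX11a Wd 5) (hnsd : ¬ Surj Wd 5)
    (hvd : (5 : ℕ) ∣ padicValInt 5 Wd.minimalDiscriminantInt)
    {N : ℕ} [NeZero N] (f : CuspForm (CongruenceSubgroup.Gamma0 N) 2) (hf : ModularForms.IsNewformOf Wd f)
    (ϖ : ℚ) (hϖ : (ϖ : ℝ) * Wd.realPeriodRat = ModularForms.plusPeriod f)
    (a : ℚ_[5]) (L : PowerSeries ℚ_[5])
    (ha₁ : Wd.HasSplitMultiplicativeReductionAtPrime 5 → a = 1) (ha₂ : ¬ Wd.HasSplitMultiplicativeReductionAtPrime 5 → a = -1)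
    (hLf : IsMultPAdicLFunctionOf f 5 a L) :
    ∃ n : ℕ, ‖PowerSeries.coeff n (PowerSeries.C ((ϖ : ℚ) : ℚ_[5]) * L)‖ = 1 := by
  obtain ⟨hX, hns, h57, hv, hram, hs⟩ := deepHypotheses W hW hr hSha
  exact h W 5 hX hns h57 hv hram hs K Wd Cd hK hH hL hCd hXd hnsd hvd f hf ϖ hϖ a L ha₁ ha₂ hLf

end T7o10d2

/-! ## Kernel pair facts of `E₀ = [0, 0, 0, -1212402243, -78518091456958]` (`J9t-13o10d43`, `j = J₉(-13/10)`, `N = 1831746759120 = 2⁴·3⁴·5·17²·23²·43²`) at `p = 5` -/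

namespace Tm13o10d43

/-- `Δ(E₀) = -2549262643014384053994700800000`. [cite: SilvermanAEC2009, III.1] -/
theorem Δ_eq : (⟨0, 0, 0, -1212402243, -78518091456958⟩ : WeierstrassCurve ℤ).Δ = -2549262643014384053994700800000 := by
  decide

/-- `Δ(E₀) = -2¹⁷·3⁴·5⁵·17²·23²·43⁹` (bad primes `2, 3, 5, 17, 23, 43`; `N = 2⁴·3⁴·5·17²·23²·43²`). [cite: SilvermanAEC2009, VII.5 Prop. 5.1] -/
theorem Δ_eq_factored : (⟨0, 0, 0, -1212402243, -78518091456958⟩ : WeierstrassCurve ℤ).Δ =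
    -(2 ^ 17 * 3 ^ 4 * 5 ^ 5 * 17 ^ 2 * 23 ^ 2 * 43 ^ 9) := by
  rw [Δ_eq]; norm_num

/-- `c₄(E₀) = 58195307664 = 2⁴·3²·13·17·23·43³`. [cite: SilvermanAEC2009, III.1] -/
theorem c₄_eq : (⟨0, 0, 0, -1212402243, -78518091456958⟩ : WeierstrassCurve ℤ).c₄ = 58195307664 := by
  decide

/-- `#Ẽ₀(𝔽_11) = 18` (`a_11 = -6`), kernel-decided. [cite: SilvermanAEC2009, V.2] -/
theorem card_F11 : Nat.card (((⟨0, 0, 0, -1212402243, -78518091456958⟩ : WeierstrassCurve ℤ).map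
    (Int.castRingHom (ZMod 11))).toAffine.Point) = 18 := by
  rw [@natCard_point_eq_one_add_card (ZMod 11) (@ZMod.instField 11 ⟨by norm_num⟩) _ _ _ (by decide)]
  decide

/-- `E` is an elliptic curve (`Δ ≠ 0`). [cite: SilvermanAEC2009, III.1] -/
theorem isElliptic (W : WeierstrassCurve ℚ) (hW : W = ⟨0, 0, 0, -1212402243, -78518091456958⟩) : W.IsElliptic := by
  subst hW; exact isElliptic_of_discOf_ne_zero 0 0 0 (-1212402243) (-78518091456958) (by decide +kernel)

/-- The model is GLOBALLY MINIMAL: Silverman's criterion at every odd prime below `512` (all `ord_q Δ < 12` there), `|Δ| < 512¹²`,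
and Kraus's condition at `2` (`2¹⁷ ∥ Δ`, `2⁴ ∥ c₄`, `2⁶ ∥ c₆`). [cite: Kraus1989, Prop. 1] [cite: SilvermanAEC2009, VII.1 Remark 1.1] -/
theorem isGloballyMinimal (W : WeierstrassCurve ℚ) (hW : W = ⟨0, 0, 0, -1212402243, -78518091456958⟩) : W.IsGloballyMinimal := by
  subst hW
  exact isGloballyMinimal_of_kraus_two_bounded 0 0 0 (-1212402243) (-78518091456958) 512
    (by decide +kernel) (by decide +kernel) (by decide +kernel) (by decide +kernel)

/-- The tree's integral model of `E` is `E₀`. [folklore] -/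
theorem integralModelInt_eq (W : WeierstrassCurve ℚ) (hW : W = ⟨0, 0, 0, -1212402243, -78518091456958⟩) [W.IsGloballyMinimal] :
    integralModelInt W = ⟨0, 0, 0, -1212402243, -78518091456958⟩ := by
  subst hW; exact integralModelInt_eq_of_map_eq _ (map_mk_int _ _ _ _ _)

/-- `E` as the base change of its integer model. [folklore] -/
theorem eq_baseChange (W : WeierstrassCurve ℚ) (hW : W = ⟨0, 0, 0, -1212402243, -78518091456958⟩) :
    W = (⟨0, 0, 0, -1212402243, -78518091456958⟩ : WeierstrassCurve ℤ).baseChange ℚ := by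
  rw [hW]; ext <;> simp [WeierstrassCurve.baseChange, WeierstrassCurve.map]

/-- **Multiplicative reduction at `5`** (`5 ∣ Δ`, `5 ∤ c₄`). [cite: SilvermanAEC2009, VII.5 Prop. 5.1(b)] -/
theorem mult_five (W : WeierstrassCurve ℚ) (hW : W = ⟨0, 0, 0, -1212402243, -78518091456958⟩) [W.IsElliptic] [W.IsGloballyMinimal]
    [Fact (Nat.Prime 5)] : Mult W 5 :=
  hasMultiplicativeReductionAtPrime_of_intModel (integralModelInt_eq W hW) 5
    (by rw [Δ_eq]; decide) (by rw [c₄_eq]; decide)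

/-- `ord₅ Δ_min(E) = 5`. [cite: SilvermanAEC2009, VII.5 Prop. 5.1(b)] -/
theorem padicValInt_five (W : WeierstrassCurve ℚ) (hW : W = ⟨0, 0, 0, -1212402243, -78518091456958⟩) [W.IsElliptic] [W.IsGloballyMinimal]
    [Fact (Nat.Prime 5)] : padicValInt 5 W.minimalDiscriminantInt = 5 := by
  rw [minimalDiscriminantInt_eq (integralModelInt_eq W hW), Δ_eq]
  exact padicValInt_eq_of_dvd_of_not_dvd 5 (by decide) (by decide)

/-- The crux binder **`5 ∣ ord₅ Δ_min(E)`** (`5 = 5·1`). [cite: SilvermanAEC2009, VII.5 Prop. 5.1(b)] -/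
theorem dvd_padicValInt_five (W : WeierstrassCurve ℚ) (hW : W = ⟨0, 0, 0, -1212402243, -78518091456958⟩) [W.IsElliptic] [W.IsGloballyMinimal]
    [Fact (Nat.Prime 5)] : (5 : ℕ) ∣ padicValInt 5 W.minimalDiscriminantInt := by
  have h := padicValInt_five W hW
  omega

/-- **`E[5]` is irreducible**: Frobenius no-root witness at the good prime `ℓ = 11` (`a₁₁ = -6`, `X² + 6X + 11` root-free mod `5`;
Mazur 1978 Prop. 6.3 (1)). [cite: Mazur1978, §6 Prop. 6.3 (1) (p. 153)] -/
theorem irr_five (W : WeierstrassCurve ℚ) (hW : W = ⟨0, 0, 0, -1212402243, -78518091456958⟩) [W.IsElliptic] [W.IsGloballyMinimal]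
    [Fact (Nat.Prime 5)] : Irr W 5 :=
  haveI : Fact (Nat.Prime 11) := ⟨by norm_num⟩
  hasIrreducibleModPGaloisRep_of_intModel_of_noroot (integralModelInt_eq W hW) 5 11
    (by decide) (by rw [Δ_eq]; decide) card_F11
    (of_decide_eq_true rfl)

/-- **Every prime of multiplicative reduction of `E` is `5`**: it divides `Δ = -2¹⁷·3⁴·5⁵·17²·23²·43⁹`, and `2`, `3`, `17`, `23`, `43` are additive
(`q ∣ Δ`, `q ∣ c₄` at the globally minimal model). [cite: SilvermanAEC2009, VII.5 Prop. 5.1] -/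
theorem eq_five_of_mult (W : WeierstrassCurve ℚ) (hW : W = ⟨0, 0, 0, -1212402243, -78518091456958⟩) [W.IsElliptic] [W.IsGloballyMinimal]
    {ℓ : ℕ} [hℓ : Fact ℓ.Prime] (hm : Mult W ℓ) : ℓ = 5 := by
  have hI := integralModelInt_eq W hW
  have hdvd : (ℓ : ℤ) ∣ (⟨0, 0, 0, -1212402243, -78518091456958⟩ : WeierstrassCurve ℤ).Δ := by
    by_contra hnd
    exact (hasGoodReductionAtPrime_of_not_dvd W ℓ (by rwa [minimalDiscriminantInt_eq hI])).not_hasMultiplicativeReduction _ hm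
  rw [Δ_eq_factored, Int.dvd_neg, Int.natCast_dvd] at hdvd
  simp only [Int.natAbs_mul, Int.natAbs_pow] at hdvd
  have hp := hℓ.out
  have hadd : ∀ q : ℕ, [Fact q.Prime] → (q : ℤ) ∣ (⟨0, 0, 0, -1212402243, -78518091456958⟩ : WeierstrassCurve ℤ).Δ →
      (q : ℤ) ∣ (⟨0, 0, 0, -1212402243, -78518091456958⟩ : WeierstrassCurve ℤ).c₄ → ¬ Mult W q :=
    fun q _ hΔ hc ↦ not_hasMultiplicativeReductionAtPrime_of_intModel_of_dvd_of_dvd hI q hΔ hc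
  rcases (Nat.Prime.dvd_mul hp).mp hdvd with hdvd | h43
  · rcases (Nat.Prime.dvd_mul hp).mp hdvd with hdvd | h23
    · rcases (Nat.Prime.dvd_mul hp).mp hdvd with hdvd | h17
      · rcases (Nat.Prime.dvd_mul hp).mp hdvd with hdvd | h5
        · rcases (Nat.Prime.dvd_mul hp).mp hdvd with hdvd | h3
          · exfalso
            have h' : ℓ = 2 := (Nat.prime_dvd_prime_iff_eq hp (by norm_num : Nat.Prime 2)).mp (hp.dvd_of_dvd_pow hdvd)
            subst h'
            exact hadd 2 (by rw [Δ_eq]; decide) (by rw [c₄_eq]; decide) hm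
          · exfalso
            have h' : ℓ = 3 := (Nat.prime_dvd_prime_iff_eq hp (by norm_num : Nat.Prime 3)).mp (hp.dvd_of_dvd_pow h3)
            subst h'
            exact hadd 3 (by rw [Δ_eq]; decide) (by rw [c₄_eq]; decide) hm
        · exact (Nat.prime_dvd_prime_iff_eq hp (by norm_num : Nat.Prime 5)).mp (hp.dvd_of_dvd_pow h5)
      · exfalso
        have h' : ℓ = 17 := (Nat.prime_dvd_prime_iff_eq hp (by norm_num : Nat.Prime 17)).mp (hp.dvd_of_dvd_pow h17)
        subst h'
        exact hadd 17 (by rw [Δ_eq]; decide) (by rw [c₄_eq]; decide) hm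
    · exfalso
      have h' : ℓ = 23 := (Nat.prime_dvd_prime_iff_eq hp (by norm_num : Nat.Prime 23)).mp (hp.dvd_of_dvd_pow h23)
      subst h'
      exact hadd 23 (by rw [Δ_eq]; decide) (by rw [c₄_eq]; decide) hm
  · exfalso
    have h' : ℓ = 43 := (Nat.prime_dvd_prime_iff_eq hp (by norm_num : Nat.Prime 43)).mp (hp.dvd_of_dvd_pow h43)
    subst h'
    exact hadd 43 (by rw [Δ_eq]; decide) (by rw [c₄_eq]; decide) hm

/-- The crux binder **no (ram) witness at `5`**: `E` has no multiplicative prime other than `5`.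
[cite: SkinnerUrban2014, Thm. 2 (p. 3), hypothesis (ram)] -/
theorem not_ram_five (W : WeierstrassCurve ℚ) (hW : W = ⟨0, 0, 0, -1212402243, -78518091456958⟩) [W.IsElliptic] [W.IsGloballyMinimal]
    [Fact (Nat.Prime 5)] : ¬ Ram W 5 := by
  rintro ⟨ℓ, hℓ, hne, hm, -⟩
  exact hne (eq_five_of_mult W hW hm)

/-- **`j(E) = J₉(-13/10)`** on Zywina's `X_{G₉}` j-line: `j = c₄³/Δ = −7731243/100000 = t³(t² + 5t + 40)` at `t = -13/10`.
[cite: Zywina2015, §1.3 (J₉) and Thm. 1.4 (arXiv:1508.07660)] -/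
theorem j_eq_J9 (W : WeierstrassCurve ℚ) (hW : W = ⟨0, 0, 0, -1212402243, -78518091456958⟩) [W.IsElliptic] :
    W.j = (-13 / 10 : ℚ) ^ 3 * ((-13 / 10 : ℚ) ^ 2 + 5 * (-13 / 10) + 40) := by
  have hW' := eq_baseChange W hW
  subst hW'
  rw [j_baseChange_int, c₄_eq, Δ_eq]; norm_num

/-- **`ρ̄_{E,5}` is NOT onto** — a THEOREM: `E` is non-CM (multiplicative at `5`) and `j(E) = J₉(-13/10)`, so the tree's
`zywina2015_thm14_not_surjective_five_of_j_eq_J9_holds` applies. [cite: Zywina2015, Thm. 1.4 (i = 9) (arXiv:1508.07660)]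
[cite: SilvermanATAEC1994, Thm. II.6.4] -/
theorem not_surj_five (W : WeierstrassCurve ℚ) (hW : W = ⟨0, 0, 0, -1212402243, -78518091456958⟩) [W.IsElliptic] [W.IsGloballyMinimal]
    [Fact (Nat.Prime 5)] : ¬ Surj W 5 :=
  zywina2015_thm14_not_surjective_five_of_j_eq_J9_holds W
    (fun hCM ↦ not_hasMultiplicativeReductionAtPrime_of_hasCM W hCM 5 (mult_five W hW)) (-13 / 10) (j_eq_J9 W hW)

/-- **`(E, 5) ∈ X11b`** given `r_an(E) = 1` (`hr`; numerics: root number `−1`, `L'(E,1) = 13.4779954…`, `ellrank` = `[1,1,0]`, lane B g15 kit j331690).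
[cite: Miller2011LMS, §1] -/
theorem classX11b_five (W : WeierstrassCurve ℚ) (hW : W = ⟨0, 0, 0, -1212402243, -78518091456958⟩) [W.IsElliptic] [W.IsGloballyMinimal]
    [Fact (Nat.Prime 5)] (hr : W.analyticRank = 1) : ClassX11b W 5 :=
  ⟨hr, by decide, mult_five W hW, irr_five W hW⟩

/-- **THE DEEP CHILDREN ARE INHABITED AT `(J9t-13o10d43, 5)` modulo two analytic numerics**: the common outer hypotheses of
`Theorems.NonSurjCornerKolyZDeep` (23046) and `Theorems.NonSurjCornerTwinMuAnDeep` (23047) hold at `E` given `hr : r_an = 1` and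
`hSha : ∃ s, shaAn E = s ∧ 0 < ord₅ s` (numerics, kit j331491 ∕ j331690 at 38 digits: `L'(E,1) = 13.4779954…`, generator of height `ĥ = 12.2879332…`
saturated at every prime `≤ 500`, `X = L'(E,1)·#tors²∕(Ω·∏c) = 307.1983324…`, `#Ш(E)_an = X∕ĥ = 25.000000…`). [cite: Zywina2015, Thm. 1.4 (i = 9)]
[cite: GrossZagier1986, Thm. I.6.3 (the L'-value behind #Ш_an)] -/
theorem deepHypotheses (W : WeierstrassCurve ℚ) (hW : W = ⟨0, 0, 0, -1212402243, -78518091456958⟩) [W.IsElliptic]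
    [W.IsGloballyMinimal] [Fact (Nat.Prime 5)] (hr : W.analyticRank = 1)
    (hSha : ∃ s : ℚ, shaAn W = (s : ℂ) ∧ 0 < padicValRat 5 s) :
    ClassX11b W 5 ∧ ¬ Surj W 5 ∧ ((5 : ℕ) = 5 ∨ (5 : ℕ) = 7) ∧
      (5 : ℕ) ∣ padicValInt 5 W.minimalDiscriminantInt ∧ ¬ Ram W 5 ∧
      (∃ s : ℚ, shaAn W = (s : ℂ) ∧ 0 < padicValRat 5 s) :=
  ⟨classX11b_five W hW hr, not_surj_five W hW, Or.inl rfl, dvd_padicValInt_five W hW, not_ram_five W hW, hSha⟩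

/-- **What 23047 says at `J9t-13o10d43`** (its inner statement at this pair, for every Heegner field `K` with `L(E^{(d_K)},1) ≠ 0` and every model of
the twist), from the decl BY NAME and the two analytic binders. Nothing is asserted: the decl is a hypothesis. [cite: GreenbergLNM1716, §1 Conj. 1.11 (p. 61) (shape)] -/
theorem twinMuAnDeep_at (h : NonSurjCornerTwinMuAnDeep)
    (W : WeierstrassCurve ℚ) (hW : W = ⟨0, 0, 0, -1212402243, -78518091456958⟩) [W.IsElliptic] [W.IsGloballyMinimal]
    [Fact (Nat.Prime 5)] (hr : W.analyticRank = 1) (hSha : ∃ s : ℚ, shaAn W = (s : ℂ) ∧ 0 < padicValRat 5 s)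
    (K : Type) [Field K] [NumberField K] (Wd : WeierstrassCurve ℚ) [Wd.IsElliptic] [Wd.IsGloballyMinimal] (Cd : VariableChange ℚ)
    (hK : IsImaginaryQuadratic K) (hH : SatisfiesHeegnerHypothesis (W.conductorNorm ℤ) K)
    (hL : (W.quadraticTwist (NumberField.discr K : ℚ)).entireLFunction 1 ≠ 0)
    (hCd : Cd • W.quadraticTwist (NumberField.discr K : ℚ) = Wd)
    (hXd : ClassX11a Wd 5) (hnsd : ¬ Surj Wd 5)
    (hvd : (5 : ℕ) ∣ padicValInt 5 Wd.minimalDiscriminantInt)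
    {N : ℕ} [NeZero N] (f : CuspForm (CongruenceSubgroup.Gamma0 N) 2) (hf : ModularForms.IsNewformOf Wd f)
    (ϖ : ℚ) (hϖ : (ϖ : ℝ) * Wd.realPeriodRat = ModularForms.plusPeriod f)
    (a : ℚ_[5]) (L : PowerSeries ℚ_[5])
    (ha₁ : Wd.HasSplitMultiplicativeReductionAtPrime 5 → a = 1) (ha₂ : ¬ Wd.HasSplitMultiplicativeReductionAtPrime 5 → a = -1)
    (hLf : IsMultPAdicLFunctionOf f 5 a L) :
    ∃ n : ℕ, ‖PowerSeries.coeff n (PowerSeries.C ((ϖ : ℚ) : ℚ_[5]) * L)‖ = 1 := by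
  obtain ⟨hX, hns, h57, hv, hram, hs⟩ := deepHypotheses W hW hr hSha
  exact h W 5 hX hns h57 hv hram hs K Wd Cd hK hH hL hCd hXd hnsd hvd f hf ϖ hϖ a L ha₁ ha₂ hLf

end Tm13o10d43

end Summit.BirchSwinnertonDyer.BirchSwinnertonDyer.Theorems.CornerFive

end
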